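import Literature.NumberTheory.Sieve.LargeSieveLargeConductors
import HarnessLib

/-!
# Primes/sequences in arithmetic progressions to all moduli `h ≤ Q`: the character expansion of a
# class sum, Parseval over the reduced classes, and the mean square of the LARGE-CONDUCTOR part
# (Barban–Davenport–Halberstam, large-sieve half, in class form) — proved

Companion of `LargeSieveLargeConductors` (`sum_totient_inv_largeConductor_le`). For complex `a_n` on
`(M₀, M₀ + N]`, a modulus `h ≥ 1` and a reduced class `c`:

* `apSum_eq_charExpansion` — `∑_{n ≡ c (h)} a_n = φ(h)⁻¹ ∑_{χ mod h} χ(c⁻¹) ∑_n a_n χ(n)` (orthogonality);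
* `sum_units_norm_sq_charComb` — PARSEVAL over the reduced classes for any finite family `T` of
  characters mod `h`: `∑_{c ∈ (ℤ/h)ˣ} |∑_{χ ∈ T} χ(c⁻¹) v_χ|² = φ(h) ∑_{χ ∈ T} |v_χ|²`;
* `sum_units_norm_sq_largePart_eq` — hence the part of the class sum carried by the characters of
  conductor `> R`, `L_R(h,c) := φ(h)⁻¹ ∑_{cond χ > R} χ(c⁻¹) ∑_n a_n χ(n)`, has
  `∑_c |L_R(h,c)|² = φ(h)⁻¹ ∑_{cond χ > R} |∑_n a_n χ(n)|²`;
* `sum_largeConductor_le_sum_primIndex` — `∑_{χ mod h, cond χ > R} |∑ a χ|² ≤ ∑_{(d,ψ) ∈ S(h), d > R} |∑ a ψ_h|²`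
  (re-indexing by the tree's `primIndex h` / `induce h`, `conductor_changeLevel`), so that
  `sum_totient_inv_largeConductor_le` applies: summed over `h ≤ Q` with the weight `1` these mean squares
  are `≤ (1 + log Q)²(2(N+1)/R + 4Q) ∑|a_n|²` (`sum_totient_inv_largeConductor_le'`, class form).

With Cauchy–Schwarz this is the form a dispersion-free user needs: for weights `W(h,c)`,
`|∑_{h ≤ Q} ∑_c W(h,c) L_R(h,c)| ≤ ‖W‖₂ · (1 + log Q)·(2(N+1)/R + 4Q)^{1/2}·‖a‖₂` — the "level of
distribution `Q` up to `N^{1−δ}`, saving `R^{−1/2}`" statement for sequences whose residues are spread over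
many classes (Davenport ch. 29; Iwaniec–Kowalski §17.3). Pure inequalities for finite sequences; no primes,
no Siegel–Walfisz. Standard axioms.

## References
* [Davenport1980] ch. 29 (Barban–Davenport–Halberstam: character expansion, Parseval, large sieve) — derivation.
* [IwaniecKowalski2004] Thm 7.13 (large sieve), §17.3 — derivation.
-/

noncomputable section

open Finset Real Complex
open scoped ComplexConjugate

namespace Literature.NumberTheory.Sieve.LargeSieve

section OneModulus

variable {h : ℕ} [NeZero h]

/-- Orthogonality over the reduced classes for one character: `∑_{c ∈ (ℤ/h)ˣ} ψ(c⁻¹) = φ(h)` if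
`ψ = 1` and `0` otherwise. [folklore] -/
private theorem sum_units_apply_inv_eq (ψ : DirichletCharacter ℂ h) :
    ∑ c : (ZMod h)ˣ, ψ ((c⁻¹ : (ZMod h)ˣ) : ZMod h) = if ψ = 1 then (h.totient : ℂ) else 0 := by
  have hre : ∑ c : (ZMod h)ˣ, ψ ((c⁻¹ : (ZMod h)ˣ) : ZMod h) = ∑ c : (ZMod h)ˣ, ψ (c : ZMod h) :=
    Fintype.sum_equiv (Equiv.inv (ZMod h)ˣ) _ _ fun c => by simp
  rw [hre]
  split_ifs with hψ
  · subst hψ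
    simp only [MulChar.one_apply_coe, Finset.sum_const, Finset.card_univ, nsmul_eq_mul, mul_one,
      ZMod.card_units_eq_totient]
  · exact sum_units_eq_zero_of_ne_one hψ

/-- The pair orthogonality: `∑_{c ∈ (ℤ/h)ˣ} χ(c⁻¹)·conj(χ'(c⁻¹)) = φ(h)·[χ = χ']`. [folklore] -/
private theorem sum_units_apply_mul_conj_eq (χ χ' : DirichletCharacter ℂ h) :
    ∑ c : (ZMod h)ˣ, χ ((c⁻¹ : (ZMod h)ˣ) : ZMod h) * conj (χ' ((c⁻¹ : (ZMod h)ˣ) : ZMod h)) =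
      if χ = χ' then (h.totient : ℂ) else 0 := by
  have hmul : ∀ c : (ZMod h)ˣ, χ ((c⁻¹ : (ZMod h)ˣ) : ZMod h) * conj (χ' ((c⁻¹ : (ZMod h)ˣ) : ZMod h)) =
      (χ * χ'⁻¹) ((c⁻¹ : (ZMod h)ˣ) : ZMod h) := by
    intro c
    rw [conj_apply_eq_inv_apply, MulChar.mul_apply]
  simp_rw [hmul]
  rw [sum_units_apply_inv_eq (χ * χ'⁻¹)]
  simp only [mul_inv_eq_one]

/-- **Parseval over the reduced classes** for a finite family `T` of characters mod `h` and
coefficients `v`: `∑_{c ∈ (ℤ/h)ˣ} |∑_{χ ∈ T} χ(c⁻¹) v_χ|² = φ(h) · ∑_{χ ∈ T} |v_χ|²`.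
[cite: Davenport1980, ch. 29 — derivation] -/
theorem sum_units_norm_sq_charComb (T : Finset (DirichletCharacter ℂ h)) (v : DirichletCharacter ℂ h → ℂ) :
    ∑ c : (ZMod h)ˣ, ‖∑ χ ∈ T, χ ((c⁻¹ : (ZMod h)ˣ) : ZMod h) * v χ‖ ^ 2 =
      (h.totient : ℝ) * ∑ χ ∈ T, ‖v χ‖ ^ 2 := by
  -- work in `ℂ`: `|z|² = z · conj z`
  have hsq : ∀ z : ℂ, ((‖z‖ : ℝ) : ℂ) ^ 2 = z * conj z := by
    intro z; rw [Complex.mul_conj, Complex.normSq_eq_norm_sq, Complex.ofReal_pow]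
  apply Complex.ofReal_injective
  push_cast
  simp_rw [hsq]
  -- expand the product of the two sums and exchange
  have hexp : ∀ c : (ZMod h)ˣ,
      (∑ χ ∈ T, χ ((c⁻¹ : (ZMod h)ˣ) : ZMod h) * v χ) * conj (∑ χ ∈ T, χ ((c⁻¹ : (ZMod h)ˣ) : ZMod h) * v χ) =
        ∑ χ ∈ T, ∑ χ' ∈ T, (v χ * conj (v χ')) *
          (χ ((c⁻¹ : (ZMod h)ˣ) : ZMod h) * conj (χ' ((c⁻¹ : (ZMod h)ˣ) : ZMod h))) := by
    intro c
    rw [map_sum, Finset.sum_mul_sum]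
    refine Finset.sum_congr rfl fun χ _ => Finset.sum_congr rfl fun χ' _ => ?_
    rw [map_mul]; ring
  simp_rw [hexp]
  rw [Finset.sum_comm]
  simp_rw [Finset.sum_comm (s := (Finset.univ : Finset (ZMod h)ˣ)), ← Finset.mul_sum,
    sum_units_apply_mul_conj_eq]
  simp only [mul_ite, mul_zero, Finset.sum_ite_eq, Finset.mul_sum]
  refine Finset.sum_congr rfl fun χ hχ => ?_
  simp only [hχ, if_true]
  ring

/-- **The character expansion of a class sum** (orthogonality): for a reduced class `c` mod `h`,
`∑_{M₀ < n ≤ M₀+N, n ≡ c (h)} a_n = φ(h)⁻¹ ∑_{χ mod h} χ(c⁻¹) ∑_n a_n χ(n)`.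
[cite: Davenport1980, ch. 29 — derivation] -/
theorem apSum_eq_charExpansion (a : ℕ → ℂ) (M₀ N : ℕ) (c : (ZMod h)ˣ) :
    ∑ n ∈ (Ioc M₀ (M₀ + N)).filter (fun n : ℕ => (n : ZMod h) = ((c : (ZMod h)ˣ) : ZMod h)), a n =
      ((h.totient : ℂ))⁻¹ * ∑ χ : DirichletCharacter ℂ h,
        χ ((c⁻¹ : (ZMod h)ˣ) : ZMod h) * ∑ n ∈ Ioc M₀ (M₀ + N), a n * χ n := by
  have hφ : (h.totient : ℂ) ≠ 0 := by exact_mod_cast (Nat.totient_pos.2 (NeZero.pos h)).ne'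
  have horth : ∀ n : ℕ, ∑ χ : DirichletCharacter ℂ h, χ ((c⁻¹ : (ZMod h)ˣ) : ZMod h) * χ n =
      if ((c : (ZMod h)ˣ) : ZMod h) = (n : ZMod h) then (h.totient : ℂ) else 0 := by
    intro n
    rw [← ZMod.inv_coe_unit]
    exact DirichletCharacter.sum_char_inv_mul_char_eq ℂ (Units.isUnit c) (n : ZMod h)
  calc ∑ n ∈ (Ioc M₀ (M₀ + N)).filter (fun n : ℕ => (n : ZMod h) = ((c : (ZMod h)ˣ) : ZMod h)), a n
      = ∑ n ∈ Ioc M₀ (M₀ + N), (if ((c : (ZMod h)ˣ) : ZMod h) = (n : ZMod h) then a n else 0) := by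
        rw [Finset.sum_filter]
        refine Finset.sum_congr rfl fun n _ => ?_
        by_cases hn : (n : ZMod h) = ((c : (ZMod h)ˣ) : ZMod h)
        · rw [if_pos hn, if_pos hn.symm]
        · rw [if_neg hn, if_neg fun h' => hn h'.symm]
    _ = ∑ n ∈ Ioc M₀ (M₀ + N), ((h.totient : ℂ))⁻¹ * (a n *
          ∑ χ : DirichletCharacter ℂ h, χ ((c⁻¹ : (ZMod h)ˣ) : ZMod h) * χ n) := by
        refine Finset.sum_congr rfl fun n _ => ?_
        rw [horth n]
        split_ifs
        · field_simp
        · simp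
    _ = ((h.totient : ℂ))⁻¹ * ∑ n ∈ Ioc M₀ (M₀ + N), ∑ χ : DirichletCharacter ℂ h,
          a n * (χ ((c⁻¹ : (ZMod h)ˣ) : ZMod h) * χ n) := by
        rw [← Finset.mul_sum]
        congr 1
        exact Finset.sum_congr rfl fun n _ => by rw [Finset.mul_sum]
    _ = ((h.totient : ℂ))⁻¹ * ∑ χ : DirichletCharacter ℂ h, ∑ n ∈ Ioc M₀ (M₀ + N),
          a n * (χ ((c⁻¹ : (ZMod h)ˣ) : ZMod h) * χ n) := by
        rw [Finset.sum_comm]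
    _ = ((h.totient : ℂ))⁻¹ * ∑ χ : DirichletCharacter ℂ h,
          χ ((c⁻¹ : (ZMod h)ˣ) : ZMod h) * ∑ n ∈ Ioc M₀ (M₀ + N), a n * χ n := by
        congr 1
        refine Finset.sum_congr rfl fun χ _ => ?_
        rw [Finset.mul_sum]
        exact Finset.sum_congr rfl fun n _ => by ring

open scoped Classical in
/-- **Mean square of the large-conductor part over the classes.** With
`L_R(h,c) = φ(h)⁻¹ ∑_{χ mod h, cond χ > R} χ(c⁻¹) ∑_n a_n χ(n)`:
`∑_{c ∈ (ℤ/h)ˣ} |L_R(h,c)|² = φ(h)⁻¹ ∑_{cond χ > R} |∑_n a_n χ(n)|²`. [cite: Davenport1980, ch. 29 — derivation] -/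
theorem sum_units_norm_sq_largePart_eq (a : ℕ → ℂ) (M₀ N R : ℕ) :
    ∑ c : (ZMod h)ˣ, ‖((h.totient : ℂ))⁻¹ * ∑ χ : DirichletCharacter ℂ h with R < χ.conductor,
        χ ((c⁻¹ : (ZMod h)ˣ) : ZMod h) * ∑ n ∈ Ioc M₀ (M₀ + N), a n * χ n‖ ^ 2 =
      ((h.totient : ℝ))⁻¹ * ∑ χ : DirichletCharacter ℂ h with R < χ.conductor,
        ‖∑ n ∈ Ioc M₀ (M₀ + N), a n * χ n‖ ^ 2 := by
  have hφ0 : (0 : ℝ) < h.totient := by exact_mod_cast Nat.totient_pos.2 (NeZero.pos h)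
  set T := (Finset.univ : Finset (DirichletCharacter ℂ h)).filter (fun χ => R < χ.conductor) with hT
  set S : DirichletCharacter ℂ h → ℂ := fun χ => ∑ n ∈ Ioc M₀ (M₀ + N), a n * χ n with hSdef
  have hpull : ∀ c : (ZMod h)ˣ, ((h.totient : ℂ))⁻¹ * ∑ χ ∈ T, χ ((c⁻¹ : (ZMod h)ˣ) : ZMod h) * S χ =
      ∑ χ ∈ T, χ ((c⁻¹ : (ZMod h)ˣ) : ZMod h) * (((h.totient : ℂ))⁻¹ * S χ) := by
    intro c
    rw [Finset.mul_sum]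
    exact Finset.sum_congr rfl fun χ _ => by ring
  change ∑ c : (ZMod h)ˣ, ‖((h.totient : ℂ))⁻¹ * ∑ χ ∈ T, χ ((c⁻¹ : (ZMod h)ˣ) : ZMod h) * S χ‖ ^ 2 =
    ((h.totient : ℝ))⁻¹ * ∑ χ ∈ T, ‖S χ‖ ^ 2
  simp_rw [hpull]
  rw [sum_units_norm_sq_charComb T (fun χ => ((h.totient : ℂ))⁻¹ * S χ)]
  simp_rw [norm_mul, mul_pow, norm_inv, Complex.norm_natCast, ← Finset.mul_sum]
  field_simp

open scoped Classical in
/-- **Re-indexing by primitive inducers.** The characters mod `h` of conductor `> R` are among the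
`induce h (d, ψ)`, `(d, ψ) ∈ S(h) = primIndex h`, `d > R` (the conductor of an induced character is the level
of its primitive inducer, `conductor_changeLevel`): for `f ≥ 0`,
`∑_{χ mod h, cond χ > R} f(χ) ≤ ∑_{(d,ψ) ∈ S(h), d > R} f(ψ_h)`. [cite: Davenport1980, ch. 29 — derivation] -/
theorem sum_largeConductor_le_sum_primIndex (R : ℕ) {f : DirichletCharacter ℂ h → ℝ} (hf : ∀ χ, 0 ≤ f χ) :
    ∑ χ : DirichletCharacter ℂ h with R < χ.conductor, f χ ≤
      ∑ σ ∈ (primIndex h).filter (fun σ => R < σ.1), f (induce h σ) := by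
  have hcond : ∀ σ ∈ primIndex h, (induce h σ).conductor = σ.1 := by
    intro σ hσ
    obtain ⟨hd, -, hprim⟩ := mem_primIndex.1 hσ
    rw [induce, dif_pos hd, DirichletCharacter.conductor_changeLevel]
    exact hprim
  rw [Finset.sum_filter, Finset.sum_filter]
  calc ∑ χ : DirichletCharacter ℂ h, (if R < χ.conductor then f χ else 0)
      ≤ ∑ σ ∈ primIndex h, (if R < (induce h σ).conductor then f (induce h σ) else 0) :=
        sum_le_sum_primIndex h (f := fun χ => if R < χ.conductor then f χ else 0)
          fun χ => by split_ifs <;> simp [hf χ]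
    _ = ∑ σ ∈ primIndex h, (if R < σ.1 then f (induce h σ) else 0) :=
        Finset.sum_congr rfl fun σ hσ => by rw [hcond σ hσ]

end OneModulus

open scoped Classical in
/-- **The large-sieve half of Barban–Davenport–Halberstam, character form over all moduli.** For
complex `a_n` on `(M₀, M₀ + N]` with support coprime to every `h ≤ Q`, and `1 ≤ R`:
`∑_{h ≤ Q} φ(h)⁻¹ ∑_{χ mod h, cond χ > R} |∑_n a_n χ(n)|² ≤ (1 + log Q)²(2(N+1)/R + 4Q) ∑_n |a_n|²`.
By `sum_units_norm_sq_largePart_eq` the left side is `∑_{h ≤ Q} ∑_{c ∈ (ℤ/h)ˣ} |L_R(h,c)|²`, the mean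
square over all moduli and classes of the large-conductor part of the class sums.
[cite: Davenport1980, ch. 29 — derivation; IwaniecKowalski2004, Thm 7.13 — derivation] -/
theorem sum_totient_inv_largeConductor_le' (a : ℕ → ℂ) (M₀ N R Q : ℕ) (hR : 1 ≤ R)
    (hcop : ∀ n ∈ Ioc M₀ (M₀ + N), a n ≠ 0 → ∀ h ∈ Icc 1 Q, n.Coprime h) :
    ∑ h ∈ Icc 1 Q, ((h.totient : ℝ))⁻¹ *
        ∑ χ : DirichletCharacter ℂ h with R < χ.conductor, ‖∑ n ∈ Ioc M₀ (M₀ + N), a n * χ n‖ ^ 2 ≤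
      (1 + Real.log Q) ^ 2 * (2 * ((N : ℝ) + 1) / R + 4 * Q) *
        ∑ n ∈ Ioc M₀ (M₀ + N), ‖a n‖ ^ 2 := by
  refine le_trans (Finset.sum_le_sum fun h hh => ?_) (sum_totient_inv_largeConductor_le a M₀ N R Q hR hcop)
  have hh1 : 1 ≤ h := (mem_Icc.1 hh).1
  haveI : NeZero h := ⟨by omega⟩
  exact mul_le_mul_of_nonneg_left
    (sum_largeConductor_le_sum_primIndex R fun χ => by positivity) (inv_nonneg.2 (Nat.cast_nonneg _))

end Literature.NumberTheory.Sieve.LargeSieve
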